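import Summits.QuantumFields.QCD.Theorems.QuarksAsStableActionCriticalLineDiamagnetismCellKappaDefs
import Summits.QuantumFields.QCD.Theorems.QuarksAsStableActionCriticalLineDiamagnetismCellKappaEval
import Literature.MathematicalPhysics.QuantumLattice.GrassmannIntegralProofs

/-!
# Cell-pressure certificate — soundness layer A: complex affine forms, `4 × 4` matrices, `N⁻¹`
(crux stmt-QuantumFields-9734, line `Sketch`, stub `stub_heavyFrequencyGain`, Route B step B6; lead c3)

Enclosure semantics for the computable evaluator `…CellKappaEval` over the fixed-point affine arithmetic of
`Literature.Analysis.ValidatedNumerics.AffineArithmetic(Inv)`: `CA.mem` / `CM.mem` (entrywise `AForm.mem` at scale `S` in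
the noise symbols `ε`), soundness of `CA.zero/add/sub/mul/mulReal/mulGInt`, of `CM.ofFn/zero/add/mul/trace/gmulLeft/gmulRight/half`,
the Gaussian-integer tables of the gamma matrices (`gammaTab_spec`, `twoPMinusTab_spec`, `twoPPlusTab_spec`), the entries
of the inverse on-site block (`nInv_re`, `nInv_im`) and the soundness of its evaluator (`nInvCM_sound`, registered).
-/

open Literature.Analysis.ValidatedNumerics
open Literature.MathematicalPhysics.QuantumLattice

namespace Summit.QuantumFields.QCD.Cruxes.CriticalLineDiamagnetism.ChessboardCellGain.CellKappa

/-- `z ∈ F` at scale `S` for the noise values `ε`: real and imaginary part enclosed by the two affine forms. -/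
structure CA.mem (S : ℕ) (ε : ℕ → ℝ) (z : ℂ) (F : CA) : Prop where
  /-- the real part is enclosed -/
  re : AForm.mem S ε z.re F.re
  /-- the imaginary part is enclosed -/
  im : AForm.mem S ε z.im F.im

/-- `X ∈ F` entrywise (`4 × 4` complex matrices). -/
structure CM.mem (S : ℕ) (ε : ℕ → ℝ) (X : Matrix (Fin 4) (Fin 4) ℂ) (F : CM) : Prop where
  /-- every entry is enclosed -/
  entry : ∀ i j : Fin 4, CA.mem S ε (X i j) (F.get i j)

variable {S : ℕ} {ε : ℕ → ℝ}

/-! ### Complex affine forms -/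

namespace CA

/-- `0 ∈ CA.zero`. -/
theorem mem_zero (hS : 0 < S) : CA.mem S ε 0 zero := by
  have h := AForm.mem_const (ε := ε) hS 0
  rw [Int.cast_zero, zero_div] at h
  exact ⟨h, h⟩

/-- Soundness of the sum. -/
theorem mem_add {z w : ℂ} {F G : CA} (hz : CA.mem S ε z F) (hw : CA.mem S ε w G) :
    CA.mem S ε (z + w) (F.add G) :=
  ⟨by rw [Complex.add_re]; exact AForm.mem_add hz.1 hw.1, by rw [Complex.add_im]; exact AForm.mem_add hz.2 hw.2⟩

/-- Soundness of the difference. -/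
theorem mem_sub {z w : ℂ} {F G : CA} (hz : CA.mem S ε z F) (hw : CA.mem S ε w G) :
    CA.mem S ε (z - w) (F.sub G) :=
  ⟨by rw [Complex.sub_re]; exact AForm.mem_sub hz.1 hw.1, by rw [Complex.sub_im]; exact AForm.mem_sub hz.2 hw.2⟩

/-- Soundness of the product `(a+bi)(c+di) = (ac − bd) + (ad + bc)i`. -/
theorem mem_mul (hS : 0 < S) (hε : AForm.Valid ε) {z w : ℂ} {F G : CA} (hz : CA.mem S ε z F)
    (hw : CA.mem S ε w G) : CA.mem S ε (z * w) (mul S F G) :=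
  ⟨by rw [Complex.mul_re]; exact AForm.mem_sub (AForm.mem_mul hS hε hz.1 hw.1) (AForm.mem_mul hS hε hz.2 hw.2),
    by rw [Complex.mul_im]; exact AForm.mem_add (AForm.mem_mul hS hε hz.1 hw.2) (AForm.mem_mul hS hε hz.2 hw.1)⟩

/-- Soundness of the product with a real quantity. -/
theorem mem_mulReal (hS : 0 < S) (hε : AForm.Valid ε) {x : ℝ} {r : AForm} {z : ℂ} {F : CA}
    (hx : AForm.mem S ε x r) (hz : CA.mem S ε z F) : CA.mem S ε ((x : ℂ) * z) (mulReal S r F) :=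
  ⟨by rw [Complex.re_ofReal_mul]; exact AForm.mem_mul hS hε hx hz.1,
    by rw [Complex.im_ofReal_mul]; exact AForm.mem_mul hS hε hx hz.2⟩

/-- Soundness of the product with the Gaussian integer `a + bi` (exact). -/
theorem mem_mulGInt (a b : ℤ) {z : ℂ} {F : CA} (hz : CA.mem S ε z F) :
    CA.mem S ε (((a : ℂ) + (b : ℂ) * Complex.I) * z) (mulGInt a b F) := by
  have hre : (((a : ℂ) + (b : ℂ) * Complex.I) * z).re = a * z.re - b * z.im := by
    simp [Complex.mul_re]
  have him : (((a : ℂ) + (b : ℂ) * Complex.I) * z).im = a * z.im + b * z.re := by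
    simp [Complex.mul_im, add_comm]
  exact ⟨by rw [hre]; exact AForm.mem_sub (AForm.mem_mulInt a hz.1) (AForm.mem_mulInt b hz.2),
    by rw [him]; exact AForm.mem_add (AForm.mem_mulInt a hz.2) (AForm.mem_mulInt b hz.1)⟩

end CA

/-! ### Matrices -/

namespace CM

/-- Entry access of `CM.ofFn` (list index arithmetic on the `16` entries). -/
theorem get_ofFn (f : ℕ → ℕ → CA) {i j : ℕ} (hi : i < 4) (hj : j < 4) : (ofFn f).get i j = f i j := by
  interval_cases i <;> interval_cases j <;> rfl

/-- A matrix of forms built by `CM.ofFn` encloses `X` as soon as it does entrywise. -/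
theorem mem_ofFn {X : Matrix (Fin 4) (Fin 4) ℂ} {f : ℕ → ℕ → CA}
    (h : ∀ i j : Fin 4, CA.mem S ε (X i j) (f i j)) : CM.mem S ε X (ofFn f) :=
  ⟨fun i j => by rw [get_ofFn f i.2 j.2]; exact h i j⟩

/-- `0 ∈ CM.zero`. -/
theorem mem_zero (hS : 0 < S) : CM.mem S ε 0 zero :=
  mem_ofFn fun _ _ => CA.mem_zero hS

/-- Soundness of the sum. -/
theorem mem_add {X Y : Matrix (Fin 4) (Fin 4) ℂ} {F G : CM} (hX : CM.mem S ε X F) (hY : CM.mem S ε Y G) :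
    CM.mem S ε (X + Y) (F.add G) :=
  mem_ofFn fun i j => by rw [Matrix.add_apply]; exact CA.mem_add (hX.1 i j) (hY.1 i j)

/-- Soundness of the product (`(XY)_{ij} = Σ_k X_{ik} Y_{kj}` over `Fin 4`). -/
theorem mem_mul (hS : 0 < S) (hε : AForm.Valid ε) {X Y : Matrix (Fin 4) (Fin 4) ℂ} {F G : CM}
    (hX : CM.mem S ε X F) (hY : CM.mem S ε Y G) : CM.mem S ε (X * Y) (CM.mul S F G) :=
  mem_ofFn fun i j => by
    have e : (X * Y) i j = (X i 0 * Y 0 j + X i 1 * Y 1 j) + (X i 2 * Y 2 j + X i 3 * Y 3 j) := by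
      rw [Matrix.mul_apply, Fin.sum_univ_four, add_assoc]
    rw [e]
    exact CA.mem_add (CA.mem_add (CA.mem_mul hS hε (hX.1 i 0) (hY.1 0 j)) (CA.mem_mul hS hε (hX.1 i 1) (hY.1 1 j)))
      (CA.mem_add (CA.mem_mul hS hε (hX.1 i 2) (hY.1 2 j)) (CA.mem_mul hS hε (hX.1 i 3) (hY.1 3 j)))

/-- Soundness of the trace. -/
theorem mem_trace {X : Matrix (Fin 4) (Fin 4) ℂ} {F : CM} (hX : CM.mem S ε X F) : CA.mem S ε X.trace F.trace := by
  have e : X.trace = (X 0 0 + X 1 1) + (X 2 2 + X 3 3) := by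
    rw [Matrix.trace, Fin.sum_univ_four, add_assoc]; rfl
  rw [e]
  exact CA.mem_add (CA.mem_add (hX.1 0 0) (hX.1 1 1)) (CA.mem_add (hX.1 2 2) (hX.1 3 3))

/-- Soundness of the left multiplication by a constant Gaussian-integer matrix `G` with table `g`. -/
theorem mem_gmulLeft {g : ℕ → ℕ → ℤ × ℤ} {G X : Matrix (Fin 4) (Fin 4) ℂ} {F : CM}
    (hG : ∀ i j : Fin 4, G i j = ((g i j).1 : ℂ) + ((g i j).2 : ℂ) * Complex.I) (hX : CM.mem S ε X F) :
    CM.mem S ε (G * X) (gmulLeft g F) :=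
  mem_ofFn fun i j => by
    have e : (G * X) i j = (G i 0 * X 0 j + G i 1 * X 1 j) + (G i 2 * X 2 j + G i 3 * X 3 j) := by
      rw [Matrix.mul_apply, Fin.sum_univ_four, add_assoc]
    rw [e, hG, hG, hG, hG]
    exact CA.mem_add (CA.mem_add (CA.mem_mulGInt _ _ (hX.1 0 j)) (CA.mem_mulGInt _ _ (hX.1 1 j)))
      (CA.mem_add (CA.mem_mulGInt _ _ (hX.1 2 j)) (CA.mem_mulGInt _ _ (hX.1 3 j)))

/-- Soundness of the right multiplication by a constant Gaussian-integer matrix `G` with table `g`. -/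
theorem mem_gmulRight {g : ℕ → ℕ → ℤ × ℤ} {G X : Matrix (Fin 4) (Fin 4) ℂ} {F : CM}
    (hG : ∀ i j : Fin 4, G i j = ((g i j).1 : ℂ) + ((g i j).2 : ℂ) * Complex.I) (hX : CM.mem S ε X F) :
    CM.mem S ε (X * G) (gmulRight F g) :=
  mem_ofFn fun i j => by
    have e : (X * G) i j = (G 0 j * X i 0 + G 1 j * X i 1) + (G 2 j * X i 2 + G 3 j * X i 3) := by
      rw [Matrix.mul_apply, Fin.sum_univ_four]; ring
    rw [e, hG, hG, hG, hG]
    exact CA.mem_add (CA.mem_add (CA.mem_mulGInt _ _ (hX.1 i 0)) (CA.mem_mulGInt _ _ (hX.1 i 1)))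
      (CA.mem_add (CA.mem_mulGInt _ _ (hX.1 i 2)) (CA.mem_mulGInt _ _ (hX.1 i 3)))

/-- Integer halving is within `1` of the exact half. -/
theorem abs_ediv_two_sub_le (c : ℤ) : |((c / 2 : ℤ) : ℝ) - (c : ℝ) / 2| ≤ 1 := by
  have h1 : c = 2 * (c / 2) + c % 2 := by omega
  have h2 : 0 ≤ c % 2 := by omega
  have h3 : c % 2 ≤ 1 := by omega
  have e : ((c : ℤ) : ℝ) = 2 * ((c / 2 : ℤ) : ℝ) + ((c % 2 : ℤ) : ℝ) := by exact_mod_cast h1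
  have h2' : (0 : ℝ) ≤ ((c % 2 : ℤ) : ℝ) := by exact_mod_cast h2
  have h3' : ((c % 2 : ℤ) : ℝ) ≤ 1 := by exact_mod_cast h3
  rw [e, abs_le]
  constructor <;> linarith

/-- Halving of an affine form: `x/2` lies in `⟨⌊c/2⌋, ⌊a/2⌋, ⌊(r+1)/2⌋ + 1 + |a|⟩` (one rounding for the centre, one per
coefficient). -/
theorem mem_halfA (hε : AForm.Valid ε) {x : ℝ} {F : AForm} (hx : AForm.mem S ε x F) :
    AForm.mem S ε (x / 2) ⟨F.c / 2, F.a.map (fun x => x / 2), (F.r + 1) / 2 + 1 + F.a.length⟩ := by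
  unfold AForm.mem at hx ⊢
  have hlin := AForm.abs_lin_map_sub_le (g := fun b : ℤ => b / 2) (t := 1 / 2)
    (fun b => by rw [one_div, inv_mul_eq_div]; exact abs_ediv_two_sub_le b) hε F.a
  have hc := abs_ediv_two_sub_le F.c
  have hr : (F.r : ℝ) / 2 ≤ (((F.r + 1) / 2 : ℕ) : ℝ) := by
    have h : F.r ≤ 2 * ((F.r + 1) / 2) := by omega
    have h' : (F.r : ℝ) ≤ 2 * (((F.r + 1) / 2 : ℕ) : ℝ) := by exact_mod_cast h
    linarith
  have hx' : |(x * S - (F.c + AForm.lin ε F.a)) / 2| ≤ F.r / 2 := by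
    rw [abs_div, abs_two]; exact div_le_div_of_nonneg_right hx (by norm_num)
  have e : x / 2 * S - (((F.c / 2 : ℤ) : ℝ) + AForm.lin ε (F.a.map fun x => x / 2))
      = (x * S - (F.c + AForm.lin ε F.a)) / 2 - (((F.c / 2 : ℤ) : ℝ) - (F.c : ℝ) / 2)
        - (AForm.lin ε (F.a.map fun x => x / 2) - 1 / 2 * AForm.lin ε F.a) := by ring
  rw [e]
  push_cast
  refine (abs_sub _ _).trans ((add_le_add (abs_sub _ _) le_rfl).trans ?_)
  linarith

/-- Soundness of the halving `X ↦ ½ X`. -/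
theorem mem_half (hε : AForm.Valid ε) {X : Matrix (Fin 4) (Fin 4) ℂ} {F : CM} (hX : CM.mem S ε X F) :
    CM.mem S ε ((1 / 2 : ℂ) • X) (half F) :=
  mem_ofFn fun i j => by
    rw [Matrix.smul_apply, smul_eq_mul]
    have hre : ((1 / 2 : ℂ) * X i j).re = (X i j).re / 2 := by simp [Complex.mul_re]; ring
    have him : ((1 / 2 : ℂ) * X i j).im = (X i j).im / 2 := by simp [Complex.mul_im]; ring
    exact ⟨by rw [hre]; exact mem_halfA hε (hX.1 i j).1, by rw [him]; exact mem_halfA hε (hX.1 i j).2⟩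

end CM

/-! ### The gamma matrices -/

/-- The Gaussian-integer table `gammaTab` lists the entries of `euclideanGamma`. -/
theorem gammaTab_spec : ∀ (μ i j : Fin 4),
    euclideanGamma μ i j = ((gammaTab μ i j).1 : ℂ) + ((gammaTab μ i j).2 : ℂ) * Complex.I := by
  intro μ i j
  fin_cases μ <;> fin_cases i <;> fin_cases j <;>
    simp [euclideanGamma_zero, euclideanGamma_one, euclideanGamma_two, euclideanGamma_three, gammaTab]

/-- `twoPMinusTab μ` lists the entries of `1 − γ_μ`. -/
theorem twoPMinusTab_spec (μ : Fin 4) : ∀ (i j : Fin 4), ((1 : Matrix (Fin 4) (Fin 4) ℂ) - euclideanGamma μ) i j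
    = ((twoPMinusTab μ i j).1 : ℂ) + ((twoPMinusTab μ i j).2 : ℂ) * Complex.I := by
  intro i j
  rw [Matrix.sub_apply, gammaTab_spec, Matrix.one_apply, twoPMinusTab]
  by_cases h : i = j
  · rw [if_pos h, if_pos (congrArg Fin.val h)]; push_cast; ring
  · rw [if_neg h, if_neg (fun e => h (Fin.ext e))]; push_cast; ring

/-- `twoPPlusTab μ` lists the entries of `1 + γ_μ`. -/
theorem twoPPlusTab_spec (μ : Fin 4) : ∀ (i j : Fin 4), ((1 : Matrix (Fin 4) (Fin 4) ℂ) + euclideanGamma μ) i j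
    = ((twoPPlusTab μ i j).1 : ℂ) + ((twoPPlusTab μ i j).2 : ℂ) * Complex.I := by
  intro i j
  rw [Matrix.add_apply, gammaTab_spec, Matrix.one_apply, twoPPlusTab]
  by_cases h : i = j
  · rw [if_pos h, if_pos (congrArg Fin.val h)]; push_cast; ring
  · rw [if_neg h, if_neg (fun e => h (Fin.ext e))]; push_cast; ring

/-! ### The inverse on-site block -/

/-- The entries of `N⁻¹ = ρ⁻²(M·1 − i(s₀γ₀ + s₁γ₁))`. -/
theorem nInv_apply (M s₀ s₁ : ℝ) (i j : Fin 4) : nInv M s₀ s₁ i j = ((1 / (M ^ 2 + s₀ ^ 2 + s₁ ^ 2) : ℝ) : ℂ) *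
    ((M : ℂ) * (if i = j then 1 else 0) -
      Complex.I * ((s₀ : ℂ) * euclideanGamma 0 i j + (s₁ : ℂ) * euclideanGamma 1 i j)) := by
  simp only [nInv, Matrix.smul_apply, Matrix.sub_apply, Matrix.add_apply, smul_eq_mul, Matrix.one_apply]

/-- Real part of the entries of `N⁻¹`: `ρ⁻²(M δ_ij + s₀ Im γ₀ + s₁ Im γ₁)`. -/
theorem nInv_re (M s₀ s₁ : ℝ) (i j : Fin 4) : (nInv M s₀ s₁ i j).re = (M ^ 2 + s₀ ^ 2 + s₁ ^ 2)⁻¹ *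
    ((if (i : ℕ) = j then M else 0) + ((gammaTab 0 i j).2 : ℝ) * s₀ + ((gammaTab 1 i j).2 : ℝ) * s₁) := by
  rw [nInv_apply, gammaTab_spec, gammaTab_spec]
  simp only [Complex.mul_re, Complex.mul_im, Complex.sub_re, Complex.sub_im, Complex.add_re, Complex.add_im,
    Complex.ofReal_re, Complex.ofReal_im, Complex.I_re, Complex.I_im, Complex.intCast_re, Complex.intCast_im,
    apply_ite Complex.re, apply_ite Complex.im, Complex.one_re, Complex.one_im, Complex.zero_re, Complex.zero_im,
    Fin.val_zero, Fin.val_one, one_div]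
  by_cases h : i = j
  · rw [if_pos h, if_pos h, if_pos (congrArg Fin.val h)]; ring
  · rw [if_neg h, if_neg h, if_neg (fun e => h (Fin.ext e))]; ring

/-- Imaginary part of the entries of `N⁻¹`: `−ρ⁻²(s₀ Re γ₀ + s₁ Re γ₁)`. -/
theorem nInv_im (M s₀ s₁ : ℝ) (i j : Fin 4) : (nInv M s₀ s₁ i j).im = (M ^ 2 + s₀ ^ 2 + s₁ ^ 2)⁻¹ *
    -(((gammaTab 0 i j).1 : ℝ) * s₀ + ((gammaTab 1 i j).1 : ℝ) * s₁) := by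
  rw [nInv_apply, gammaTab_spec, gammaTab_spec]
  simp only [Complex.mul_re, Complex.mul_im, Complex.sub_re, Complex.sub_im, Complex.add_re, Complex.add_im,
    Complex.ofReal_re, Complex.ofReal_im, Complex.I_re, Complex.I_im, Complex.intCast_re, Complex.intCast_im,
    apply_ite Complex.re, apply_ite Complex.im, Complex.one_re, Complex.one_im, Complex.zero_re, Complex.zero_im,
    Fin.val_zero, Fin.val_one, one_div]
  by_cases h : i = j
  · rw [if_pos h, if_pos h]; ring
  · rw [if_neg h, if_neg h]; ring

/-- **Soundness of `nInvCM`** (registered helper): if the box coordinates `M, s₀, s₁` lie in the forms `FM, F₀, F₁` and the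
evaluator certifies `ρ² > 0`, its output encloses `N⁻¹` entrywise (tangent-form reciprocal `AForm.mem_inv` of
`ρ² = M² + s₀² + s₁²`, then one rounded product per entry). -/
theorem nInvCM_sound : ∀ (S : ℕ), 0 < S → ∀ (ε : ℕ → ℝ), AForm.Valid ε → ∀ (M s₀ s₁ : ℝ) (FM F₀ F₁ : AForm) (nI : CM), AForm.mem S ε M FM → AForm.mem S ε s₀ F₀ → AForm.mem S ε s₁ F₁ → nInvCM S FM F₀ F₁ = some nI → CM.mem S ε (nInv M s₀ s₁) nI := by
  intro S hS ε hε M s₀ s₁ FM F₀ F₁ nI hM h₀ h₁ hn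
  unfold nInvCM at hn
  split at hn
  · exact absurd hn (by simp)
  · rename_i invρ hinv
    simp only [Option.some.injEq] at hn
    subst hn
    have hρ : AForm.mem S ε (M ^ 2 + s₀ ^ 2 + s₁ ^ 2)⁻¹ invρ :=
      AForm.mem_inv hS hε hinv (AForm.mem_add (AForm.mem_add (AForm.mem_sq hS hε hM) (AForm.mem_sq hS hε h₀))
        (AForm.mem_sq hS hε h₁))
    refine CM.mem_ofFn fun i j => ⟨?_, ?_⟩
    · rw [nInv_re]
      refine AForm.mem_mul hS hε hρ (AForm.mem_add (AForm.mem_add ?_ (AForm.mem_mulInt _ h₀)) (AForm.mem_mulInt _ h₁))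
      split_ifs
      · exact hM
      · have h := AForm.mem_const (ε := ε) hS 0
        rwa [Int.cast_zero, zero_div] at h
    · rw [nInv_im]
      exact AForm.mem_mul hS hε hρ (AForm.mem_neg (AForm.mem_add (AForm.mem_mulInt _ h₀) (AForm.mem_mulInt _ h₁)))

end Summit.QuantumFields.QCD.Cruxes.CriticalLineDiamagnetism.ChessboardCellGain.CellKappa
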